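import Literature.NumberTheory.EllipticCurves.LocalRestrictionUnramifiedDescentProofs
import Literature.NumberTheory.EllipticCurves.LocalPointsIntegersSubgroup
import HarnessLib

/-!
# `E(K̄_v)^{Γ_{L̃_w}}` along a quadratic extension: Galois descent of points to `E(L_w)`, no `2`-torsion
# from `E(K_v)[2] = 0`, and unique `2^M`-divisibility (Silverman *AEC* VIII.§1, VII.6.3 / Milne I.3.3)

Topic `NumberTheory/EllipticCurves`. `Proofs`-style file: THEOREMS ONLY (no definition, no named fact, no
instance, no `sorry`). Cell `bsd-print-cf2` (seat ty2), crux `CMKolyvaginExactAtInertTwo`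
(stmt-BirchSwinnertonDyer-24277): the RAMIFIED-place input (`hram`) of the exact local descent of the
`2^M`-Selmer condition along `L = K(√d) ⊃ K` (`SelmerTorsionExactDescentProofs`,
`mem_localRestrictionKer_adicCompletion_of_fixedPoints_divisible`; consumer
`Summits/…/P2/CMKolyvaginSelmerDescentAtTwoLocal.lean`).

Setting of §§1–2 (abstract): `E = W/K`, a `K`-field `E` (`char 0`), a finite extension `E'/E` generated
by `θ'` with `θ'² = c ∈ E`, `c ≠ 0`, `E' = E + E θ'`, a `E`-embedding `j : E' → Ē`, `A = E(K̄_E) =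
localPoints W E` with its `Γ_E`-action, `H = Γ_{Ẽ'} = finGalSubgroup E'` (the fixing group of the
normal closure `Ẽ'` of `E'` in `Ē`).

§1 Galois descent of points (Silverman *AEC* I.§1 / VIII.§1: "`V(K) = {P ∈ V : P^σ = P ∀ σ}`"):
* `finGaloisClosure_le_fieldRange_of_sq_eq` — `Ẽ' = j(E')` (every `E`-embedding sends `θ'` to `± j θ'`);
* `mem_finGalSubgroup_of_smul_sqrt_eq` — an element of `Γ_E` fixing `j θ'` lies in `H`;
* `exists_map_eq_of_forall_smul_eq` — a point of `A` fixed by every `g` fixing `j(E')` pointwise is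
  `j_* P` for a point `P ∈ E(E')` (`InfiniteGalois.fixedField_fixingSubgroup`); with the two previous
  items: `exists_map_eq_of_forall_finGalSubgroup_smul_eq` (**`A^H = j_* E(E')`**) and
  `smul_map_eq_of_mem_finGalSubgroup` (`H` fixes `j_* E(E')`); the case `E' = E`:
  `exists_map_eq_of_forall_smul_eq_self` (**`A^{Γ_E} = E(E)`**).

§2 The prime `2` (`[Γ_E : H] ≤ 2`): `eq_zero_of_forall_finGalSubgroup_smul_eq_of_two_smul_eq_zero` —
**if `E(E)[2] = 0` then `A^H[2] = 0`**: every `g ∈ Γ_E` moves `t = j θ'` to `± t`, those fixing `t`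
form `H`; if some `g₀` negates `t` then for `a ∈ A^H[2]` the point `a + g₀ a` is `Γ_E`-fixed and
`2`-torsion, hence `0`, so `g₀ a = a` and `a` itself is `Γ_E`-fixed, hence `0`. Then
`eq_zero_of_forall_finGalSubgroup_smul_eq_of_two_pow_smul_eq_zero` (`A^H[2^M] = 0`).

§3 Number fields (`w ∣ v` finite places of `L = K + K θ ⊃ K`, `θ² = c ∈ K^×`, `E = K_v`, `E' = L_w`
through the map of completions): `exists_eq_add_mul_adicCompletion'` (`L_w = K_v + K_v θ`, verbatim the
private lemma of `LocalRestrictionUnramifiedDescentProofs`), `forall_exists_nsmul_eq_adicCompletion_of_torsionFree`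
(Milne I.3.3: at `w ∤ n`, `E(L_w)[n] = 0 ⟹ E(L_w) = n E(L_w)`), and the package
**`fixedPoints_twoPow_torsionFree_and_divisible_adicCompletion`**: if `w ∤ 2` and `E(K_v)[2] = 0` then
`E(K̄_v)^{Γ_{L̃_w}}` has no `2^M`-torsion and is `2^M`-divisible — literally the two hypotheses `htf`,
`hdiv` of `mem_localRestrictionKer_adicCompletion_of_fixedPoints_divisible`.

References: [SilvermanAEC2009] I.§1, VIII.§1 (proof of Prop. 1.2), Prop. VII.6.3; [MilneADT2006] I Lemma 3.3;
[SerreGaloisCohomology1997] II.§1.1; [DokchitserDokchitserAnnals2010] Lemma 4.14 (proof).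
-/

noncomputable section

open scoped Classical

universe u

namespace Literature.NumberTheory.EllipticCurves

open GaloisRepresentations NumberField Field
open _root_.WeierstrassCurve
open IsDedekindDomain (HeightOneSpectrum)

/-! ## §1 Galois descent of points along `j : E' → Ē` -/

section Abstract

variable {K : Type u} [Field K] (W : WeierstrassCurve K)
variable {E : Type u} [Field E] [Algebra K E] [CharZero E]
variable {E' : Type u} [Field E'] [Algebra K E'] [Algebra E E'] [IsScalarTower K E E']
variable (j : E' →ₐ[E] AlgebraicClosure E)

omit [CharZero E] in
/-- The action of `g ∈ Γ_E` on an affine point of `E(K̄_E)` is coordinatewise. [folklore] -/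
private theorem smul_some_localPoints (g : absoluteGaloisGroup E) {x y : AlgebraicClosure E}
    (h : (W.baseChange (AlgebraicClosure E)).toAffine.Nonsingular x y) :
    ∃ h' : (W.baseChange (AlgebraicClosure E)).toAffine.Nonsingular
        ((show AlgebraicClosure E ≃ₐ[E] AlgebraicClosure E from g) x)
        ((show AlgebraicClosure E ≃ₐ[E] AlgebraicClosure E from g) y),
      g • (show localPoints W E from Affine.Point.some _ _ h) = Affine.Point.some _ _ h' := by
  rw [localPoints.smul_def, Affine.Point.map_some]
  exact ⟨_, rfl⟩

omit [CharZero E] in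
/-- `g • j_* P = j_* P` whenever `g ∈ Γ_E` fixes `j(E')` pointwise (coordinates). [cite: SilvermanAEC2009, VIII.§1] -/
theorem smul_map_eq_of_forall_apply_eq {g : absoluteGaloisGroup E}
    (hg : ∀ z : E', (show AlgebraicClosure E ≃ₐ[E] AlgebraicClosure E from g) (j z) = j z)
    (P : (W.baseChange E').toAffine.Point) :
    g • (show localPoints W E from Affine.Point.map (j.restrictScalars K) P) =
      Affine.Point.map (j.restrictScalars K) P := by
  rw [localPoints.smul_def, Affine.Point.map_map]
  exact congrArg (fun φ : E' →ₐ[K] AlgebraicClosure E ↦ Affine.Point.map φ P)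
    (AlgHom.ext fun z ↦ hg z)

/-- **Galois descent of points to `E'`** (Silverman *AEC* I.§1 / VIII.§1): a point of `E(K̄_E)` fixed by
every `g ∈ Γ_E` that fixes `j(E')` pointwise is `j_* P` for some `P ∈ E(E')` — its coordinates lie in
the closed subfield `j(E')` (`InfiniteGalois.fixedField_fixingSubgroup`).
[cite: SilvermanAEC2009, I.§1 and VIII.§1 (proof of Prop. 1.2)] -/
theorem exists_map_eq_of_forall_smul_eq (a : localPoints W E)
    (ha : ∀ g : absoluteGaloisGroup E,
      (∀ z : E', (show AlgebraicClosure E ≃ₐ[E] AlgebraicClosure E from g) (j z) = j z) → g • a = a) :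
    ∃ P : (W.baseChange E').toAffine.Point, Affine.Point.map (j.restrictScalars K) P = a := by
  haveI : IsGalois E (AlgebraicClosure E) := {}
  -- coordinates fixed by `Fix(j(E'))` lie in `j(E')`
  have hcoord : ∀ x : AlgebraicClosure E,
      (∀ g : absoluteGaloisGroup E,
        (∀ z : E', (show AlgebraicClosure E ≃ₐ[E] AlgebraicClosure E from g) (j z) = j z) →
          (show AlgebraicClosure E ≃ₐ[E] AlgebraicClosure E from g) x = x) →
      ∃ z : E', j z = x := by
    intro x hx
    have hmem : x ∈ IntermediateField.fixedField j.fieldRange.fixingSubgroup := by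
      rw [IntermediateField.mem_fixedField_iff]
      intro g hg
      refine hx g fun z ↦ ?_
      exact (IntermediateField.mem_fixingSubgroup_iff _ _).mp hg _ (j.mem_fieldRange.mpr ⟨z, rfl⟩)
    rw [InfiniteGalois.fixedField_fixingSubgroup] at hmem
    exact j.mem_fieldRange.mp hmem
  change (W.baseChange (AlgebraicClosure E)).toAffine.Point at a
  rcases a with _ | ⟨x, y, h⟩
  · exact ⟨0, by rw [map_zero]; rfl⟩
  · have hxy : ∀ g : absoluteGaloisGroup E,
        (∀ z : E', (show AlgebraicClosure E ≃ₐ[E] AlgebraicClosure E from g) (j z) = j z) →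
          (show AlgebraicClosure E ≃ₐ[E] AlgebraicClosure E from g) x = x ∧
            (show AlgebraicClosure E ≃ₐ[E] AlgebraicClosure E from g) y = y := by
      intro g hg
      obtain ⟨h', e⟩ := smul_some_localPoints W g h
      have := e.symm.trans (ha g hg)
      exact Affine.Point.some.inj this
    obtain ⟨x', rfl⟩ := hcoord x fun g hg ↦ (hxy g hg).1
    obtain ⟨y', rfl⟩ := hcoord y fun g hg ↦ (hxy g hg).2
    have hxy0 : (W.baseChange E').toAffine.Nonsingular x' y' :=
      (Affine.baseChange_nonsingular W (j.restrictScalars K).injective x' y').mp h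
    exact ⟨Affine.Point.some _ _ hxy0, rfl⟩

/-- **`E(K̄_E)^{Γ_E} = E(E)`**: a `Γ_E`-fixed point of `E(K̄_E)` is the image of a point of `E(E)`.
[cite: SilvermanAEC2009, I.§1 and VIII.§1 (proof of Prop. 1.2)] -/
theorem exists_map_eq_of_forall_smul_eq_self (a : localPoints W E) (ha : ∀ g : absoluteGaloisGroup E, g • a = a) :
    ∃ P : (W.baseChange E).toAffine.Point,
      Affine.Point.map (IsScalarTower.toAlgHom K E (AlgebraicClosure E)) P = a := by
  obtain ⟨P, hP⟩ := exists_map_eq_of_forall_smul_eq W (Algebra.ofId E (AlgebraicClosure E)) a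
    fun g _ ↦ ha g
  exact ⟨P, hP⟩

variable {θ' : E'} {c : E}

omit [CharZero E] in
/-- **`Ẽ' ⊆ j(E')` for `E' = E + E θ'`, `θ'² = c ∈ E`**: every `E`-embedding `f : E' → Ē` maps `θ'` to
`± j θ'`, so `f(E') ⊆ j(E')` and the normal closure `Ẽ' = ⨆_f f(E')` lies in `j(E')` (the quadratic
extension `E(√c)/E` is normal). [cite: Kramer1981, §2 (p. 123), setting K = F(d^{1/2})]
[cite: SerreGaloisCohomology1997, II.§1.1] -/
theorem finGaloisClosure_le_fieldRange_of_sq_eq (hθ : θ' ^ 2 = algebraMap E E' c)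
    (hE' : ∀ x : E', ∃ a b : E, x = algebraMap E E' a + algebraMap E E' b * θ') :
    finGaloisClosure (E := E) E' ≤ j.fieldRange := by
  unfold finGaloisClosure
  rw [normalClosure_le_iff]
  intro f y hy
  obtain ⟨x, rfl⟩ := (AlgHom.mem_fieldRange (f := f)).mp hy
  obtain ⟨a, b, rfl⟩ := hE' x
  have h2 : (f θ') ^ 2 = (j θ') ^ 2 := by
    rw [← map_pow, ← map_pow, hθ, f.commutes, j.commutes]
  rcases sq_eq_sq_iff_eq_or_eq_neg.mp h2 with h | h
  · refine j.mem_fieldRange.mpr ⟨algebraMap E E' a + algebraMap E E' b * θ', ?_⟩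
    simp only [map_add, map_mul, AlgHom.commutes, h]
  · refine j.mem_fieldRange.mpr ⟨algebraMap E E' a - algebraMap E E' b * θ', ?_⟩
    simp only [map_add, map_neg, map_mul, AlgHom.commutes, h, mul_neg, sub_eq_add_neg]

omit [CharZero E] in
/-- **An element of `Γ_E` fixing `j θ'` lies in `Γ_{Ẽ'}`**: it fixes `j(E') = E + E·jθ'` pointwise,
which contains `Ẽ'`. [cite: Kramer1981, §2 (p. 123), setting K = F(d^{1/2})] [cite: SerreGaloisCohomology1997, II.§1.1] -/
theorem mem_finGalSubgroup_of_smul_sqrt_eq (hθ : θ' ^ 2 = algebraMap E E' c)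
    (hE' : ∀ x : E', ∃ a b : E, x = algebraMap E E' a + algebraMap E E' b * θ')
    {g : absoluteGaloisGroup E} (hg : g • j θ' = j θ') :
    g ∈ finGalSubgroup (E := E) E' := by
  refine (IntermediateField.mem_fixingSubgroup_iff _ _).mpr fun y hy ↦ ?_
  obtain ⟨x, rfl⟩ := j.mem_fieldRange.mp (finGaloisClosure_le_fieldRange_of_sq_eq j hθ hE' hy)
  obtain ⟨a, b, rfl⟩ := hE' x
  have hg' : (show AlgebraicClosure E ≃ₐ[E] AlgebraicClosure E from g) (j θ') = j θ' := hg
  change (show AlgebraicClosure E ≃ₐ[E] AlgebraicClosure E from g) _ = _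
  rw [map_add, map_mul, j.commutes, j.commutes, map_add, map_mul, AlgEquiv.commutes,
    AlgEquiv.commutes, hg']

omit [CharZero E] in
/-- Elements of `Γ_{Ẽ'} = Gal(Ē/Ẽ')` fix `j(E')` pointwise (`j(E') ⊆ Ẽ'`). [cite: SerreGaloisCohomology1997, II.§1.1] -/
theorem apply_eq_of_mem_finGalSubgroup {g : absoluteGaloisGroup E}
    (hg : g ∈ finGalSubgroup (E := E) E') (z : E') :
    (show AlgebraicClosure E ≃ₐ[E] AlgebraicClosure E from g) (j z) = j z :=
  (IntermediateField.mem_fixingSubgroup_iff _ _).mp hg _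
    (AlgHom.fieldRange_le_normalClosure j (j.mem_fieldRange.mpr ⟨z, rfl⟩))

omit [CharZero E] in
/-- `Γ_{Ẽ'}` fixes `j_* E(E')`. [cite: SilvermanAEC2009, VIII.§1] -/
theorem smul_map_eq_of_mem_finGalSubgroup {g : absoluteGaloisGroup E}
    (hg : g ∈ finGalSubgroup (E := E) E') (P : (W.baseChange E').toAffine.Point) :
    g • (show localPoints W E from Affine.Point.map (j.restrictScalars K) P) =
      Affine.Point.map (j.restrictScalars K) P :=
  smul_map_eq_of_forall_apply_eq W j (apply_eq_of_mem_finGalSubgroup j hg) P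

/-- **`E(K̄_E)^{Γ_{Ẽ'}} = j_* E(E')` for `E' = E + E θ'`, `θ'² ∈ E`**: an `Γ_{Ẽ'}`-fixed point of
`E(K̄_E)` is the image of a point of `E(E')`. [cite: SilvermanAEC2009, I.§1 and VIII.§1 (proof of Prop. 1.2)] -/
theorem exists_map_eq_of_forall_finGalSubgroup_smul_eq (hθ : θ' ^ 2 = algebraMap E E' c)
    (hE' : ∀ x : E', ∃ a b : E, x = algebraMap E E' a + algebraMap E E' b * θ') (a : localPoints W E)
    (ha : ∀ g ∈ finGalSubgroup (E := E) E', g • a = a) :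
    ∃ P : (W.baseChange E').toAffine.Point, Affine.Point.map (j.restrictScalars K) P = a := by
  refine exists_map_eq_of_forall_smul_eq W j a fun g hg ↦ ha g ?_
  exact mem_finGalSubgroup_of_smul_sqrt_eq j hθ hE' (hg θ')

/-! ## §2 The prime `2`: `A^{Γ_{Ẽ'}}[2] = 0` from `E(E)[2] = 0` -/

/-- A `Γ_E`-fixed point of `E(K̄_E)` killed by `n` vanishes if `E(E)` has no `n`-torsion.
[cite: SilvermanAEC2009, VIII.§1 (proof of Prop. 1.2)] -/
theorem eq_zero_of_forall_smul_eq_of_smul_eq_zero {n : ℤ}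
    (htors : ∀ P : (W.baseChange E).toAffine.Point, n • P = 0 → P = 0) {a : localPoints W E}
    (ha : ∀ g : absoluteGaloisGroup E, g • a = a) (hna : n • a = 0) : a = 0 := by
  obtain ⟨P, hP⟩ := exists_map_eq_of_forall_smul_eq_self W a ha
  have hnP : n • P = 0 := by
    apply Affine.Point.map_injective (W' := W) (IsScalarTower.toAlgHom K E (AlgebraicClosure E))
    rw [map_zsmul, map_zero]
    change n • (show localPoints W E from Affine.Point.map _ P) = 0
    rw [hP, hna]
  rw [← hP, htors P hnP, map_zero]
  rfl

omit [Algebra K E'] [IsScalarTower K E E'] in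
include j in
/-- **If `E(E)[2] = 0` then `E(K̄_E)^{Γ_{Ẽ'}}[2] = 0`** for `E' = E + E θ'`, `θ'² = c ∈ E^×`. Every
`g ∈ Γ_E` sends `t = j θ'` to `± t`, and `g t = t ⟹ g ∈ Γ_{Ẽ'}` (`mem_finGalSubgroup_of_smul_sqrt_eq`). If
all `g` fix `t`, an `Γ_{Ẽ'}`-fixed point is `Γ_E`-fixed. Otherwise pick `g₀` with `g₀ t = −t`; for
`a ∈ A^{Γ_{Ẽ'}}` with `2a = 0`, every `g` acts on `a` as `1` or as `g₀`, so `u = a + g₀ a` is `Γ_E`-fixed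
and `2`-torsion, hence `u = 0`, i.e. `g₀ a = −a = a`; then `a` is `Γ_E`-fixed, hence `0`.
[cite: SilvermanAEC2009, VIII.§1 (proof of Prop. 1.2)] [cite: SerreGaloisCohomology1997, II.§1.1] -/
theorem eq_zero_of_forall_finGalSubgroup_smul_eq_of_two_smul_eq_zero (hc : c ≠ 0)
    (hθ : θ' ^ 2 = algebraMap E E' c)
    (hE' : ∀ x : E', ∃ a b : E, x = algebraMap E E' a + algebraMap E E' b * θ')
    (htors : ∀ P : (W.baseChange E).toAffine.Point, (2 : ℤ) • P = 0 → P = 0) {a : localPoints W E}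
    (ha : ∀ g ∈ finGalSubgroup (E := E) E', g • a = a) (h2a : (2 : ℤ) • a = 0) : a = 0 := by
  set t : AlgebraicClosure E := j θ' with ht
  have ht2 : t ^ 2 = algebraMap E (AlgebraicClosure E) c := by rw [ht, ← map_pow, hθ, j.commutes]
  have ht0 : t ≠ 0 := fun h0 ↦ by
    rw [h0, zero_pow two_ne_zero, eq_comm, map_eq_zero] at ht2
    exact hc ht2
  -- every `g` sends `t` to `± t`
  have hdich : ∀ g : absoluteGaloisGroup E, g • t = t ∨ g • t = -t := by
    intro g
    have h2 : (g • t) ^ 2 = t ^ 2 := by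
      rw [absoluteGaloisGroup.smul_def, ← map_pow, ht2, AlgEquiv.commutes]
    exact sq_eq_sq_iff_eq_or_eq_neg.mp h2
  have hfix : ∀ g : absoluteGaloisGroup E, g • t = t → g • a = a := fun g hg ↦
    ha g (mem_finGalSubgroup_of_smul_sqrt_eq j hθ hE' hg)
  have hneg : -a = a := by
    rw [neg_eq_iff_add_eq_zero, ← two_zsmul]
    exact h2a
  by_cases hall : ∀ g : absoluteGaloisGroup E, g • t = t
  · exact eq_zero_of_forall_smul_eq_of_smul_eq_zero W htors (fun g ↦ hfix g (hall g)) h2a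
  · push Not at hall
    obtain ⟨g₀, hg₀⟩ := hall
    have hg₀' : g₀ • t = -t := (hdich g₀).resolve_left hg₀
    have hinv : g₀⁻¹ • t = -t := by
      rw [eq_comm, neg_eq_iff_eq_neg, ← smul_neg, ← hg₀', inv_smul_smul]
    -- every `g` acts on `a` as `1` or as `g₀`
    have hmove : ∀ g : absoluteGaloisGroup E, g • t = -t → g • a = g₀ • a := by
      intro g hg
      have h1 : (g₀⁻¹ * g) • t = t := by
        rw [mul_smul, hg, smul_neg, hinv, neg_neg]
      have h2 := hfix _ h1
      rw [mul_smul] at h2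
      calc g • a = g₀ • ((g₀⁻¹ * g) • a) := by rw [mul_smul, smul_inv_smul]
        _ = g₀ • a := by rw [mul_smul, h2]
    -- `u = a + g₀ a` is `Γ_E`-fixed and `2`-torsion
    have hu : ∀ g : absoluteGaloisGroup E, g • (a + g₀ • a) = a + g₀ • a := by
      intro g
      rcases hdich g with hg | hg
      · have hgg₀ : (g * g₀) • t = -t := by rw [mul_smul, hg₀', smul_neg, hg]
        rw [smul_add, hfix g hg, ← mul_smul, hmove _ hgg₀]
      · have hgg₀ : (g * g₀) • t = t := by rw [mul_smul, hg₀', smul_neg, hg, neg_neg]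
        rw [smul_add, hmove g hg, ← mul_smul, hfix _ hgg₀, add_comm]
    have h2u : (2 : ℤ) • (a + g₀ • a) = 0 := by rw [smul_add, smul_comm, h2a, smul_zero, add_zero]
    have hu0 := eq_zero_of_forall_smul_eq_of_smul_eq_zero W htors hu h2u
    have hg₀a : g₀ • a = a := by
      rw [add_eq_zero_iff_neg_eq] at hu0
      rw [← hu0, hneg]
    refine eq_zero_of_forall_smul_eq_of_smul_eq_zero W htors (fun g ↦ ?_) h2a
    rcases hdich g with hg | hg
    · exact hfix g hg
    · rw [hmove g hg, hg₀a]

omit [Algebra K E'] [IsScalarTower K E E'] in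
include j in
/-- **`A^{Γ_{Ẽ'}}[2^M] = 0` from `E(E)[2] = 0`** (induction on `M`: `2^{M+1} a = 0 ⟹ 2^M (2a) = 0`,
and `2a` is again `Γ_{Ẽ'}`-fixed). [cite: SilvermanAEC2009, VIII.§1 (proof of Prop. 1.2)] -/
theorem eq_zero_of_forall_finGalSubgroup_smul_eq_of_two_pow_smul_eq_zero (hc : c ≠ 0)
    (hθ : θ' ^ 2 = algebraMap E E' c)
    (hE' : ∀ x : E', ∃ a b : E, x = algebraMap E E' a + algebraMap E E' b * θ')
    (htors : ∀ P : (W.baseChange E).toAffine.Point, (2 : ℤ) • P = 0 → P = 0) (M : ℕ)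
    {a : localPoints W E} (ha : ∀ g ∈ finGalSubgroup (E := E) E', g • a = a)
    (hMa : ((2 : ℤ) ^ M) • a = 0) : a = 0 := by
  induction M generalizing a with
  | zero => simpa using hMa
  | succ M ih =>
    have h2 : ((2 : ℤ) ^ M) • ((2 : ℤ) • a) = 0 := by rw [← mul_smul, ← pow_succ, hMa]
    have h2a : (2 : ℤ) • a = 0 :=
      ih (fun g hg ↦ by rw [smul_comm, ha g hg]) h2
    exact eq_zero_of_forall_finGalSubgroup_smul_eq_of_two_smul_eq_zero W j hc hθ hE' htors ha h2a

include j in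
/-- **`A^{Γ_{Ẽ'}}` is `n`-divisible when `E(E')` is** (`A^{Γ_{Ẽ'}} = j_* E(E')`).
[cite: SilvermanAEC2009, VIII.§1] -/
theorem exists_fixed_smul_eq_of_forall_finGalSubgroup_smul_eq (hθ : θ' ^ 2 = algebraMap E E' c)
    (hE' : ∀ x : E', ∃ a b : E, x = algebraMap E E' a + algebraMap E E' b * θ') {n : ℤ}
    (hdivE' : ∀ P : (W.baseChange E').toAffine.Point, ∃ Q : (W.baseChange E').toAffine.Point, n • Q = P)
    {a : localPoints W E} (ha : ∀ g ∈ finGalSubgroup (E := E) E', g • a = a) :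
    ∃ b : localPoints W E, (∀ g ∈ finGalSubgroup (E := E) E', g • b = b) ∧ n • b = a := by
  obtain ⟨P, rfl⟩ := exists_map_eq_of_forall_finGalSubgroup_smul_eq W j hθ hE' a ha
  obtain ⟨Q, rfl⟩ := hdivE' P
  exact ⟨Affine.Point.map (j.restrictScalars K) Q, fun g hg ↦ smul_map_eq_of_mem_finGalSubgroup W j hg Q,
    by rw [map_zsmul]; rfl⟩

include j in
/-- **`E(E')` has no `2^M`-torsion when `E(E)[2] = 0`** (`j_*` is injective into `A^{Γ_{Ẽ'}}`).
[cite: SilvermanAEC2009, VIII.§1] -/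
theorem forall_point_eq_zero_of_two_pow_smul_eq_zero (hc : c ≠ 0) (hθ : θ' ^ 2 = algebraMap E E' c)
    (hE' : ∀ x : E', ∃ a b : E, x = algebraMap E E' a + algebraMap E E' b * θ')
    (htors : ∀ P : (W.baseChange E).toAffine.Point, (2 : ℤ) • P = 0 → P = 0) (M : ℕ)
    (P : (W.baseChange E').toAffine.Point) (hP : ((2 : ℤ) ^ M) • P = 0) : P = 0 := by
  apply Affine.Point.map_injective (W' := W) (j.restrictScalars K)
  rw [map_zero]
  refine eq_zero_of_forall_finGalSubgroup_smul_eq_of_two_pow_smul_eq_zero W j hc hθ hE' htors M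
    (fun g hg ↦ smul_map_eq_of_mem_finGalSubgroup W j hg P) ?_
  change ((2 : ℤ) ^ M) • Affine.Point.map (j.restrictScalars K) P = 0
  rw [← map_zsmul, hP, map_zero]

end Abstract

/-! ## §3 Number fields: `E(K̄_v)^{Γ_{L̃_w}}` for `L = K(√c)`, `w ∣ v`, `w ∤ 2` -/

section NumberField

variable {K : Type u} [Field K] [NumberField K] (W : WeierstrassCurve K)
variable (L : Type u) [Field L] [NumberField L] [Algebra K L]

omit [NumberField L] in
/-- **`L_w = K_v + K_v θ` at a finite place `w ∣ v`** when `L = K + K θ`: the `K_v`-span of `1, θ` in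
`L_w` is finite-dimensional, hence closed, and contains the dense image of `L`, so it is everything
(verbatim the private lemma `exists_eq_add_mul_adicCompletion` of `LocalRestrictionUnramifiedDescentProofs`,
exported); Neukirch, *ANT* II §8: "`L_w = L K_v`". [cite: NeukirchANT1999, Ch. II §8 (L_w = LK_v)] -/
theorem exists_eq_add_mul_adicCompletion' [NumberField L] {θ : L}
    (hL : ∀ x : L, ∃ a b : K, x = algebraMap K L a + algebraMap K L b * θ)
    (v : HeightOneSpectrum (𝓞 K)) (w : HeightOneSpectrum (𝓞 L)) [w.asIdeal.LiesOver v.asIdeal]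
    (y : w.adicCompletion L) :
    ∃ a b : v.adicCompletion K, y = adicCompletionMap (K := K) L v w a +
      adicCompletionMap (K := K) L v w b * algebraMap L (w.adicCompletion L) θ := by
  have hcont : Continuous (adicCompletionMap (K := K) L v w) := by
    unfold adicCompletionMap
    exact (HeightOneSpectrum.adicCompletion.continuous_ofCompletion L w).comp
      ((UniformSpace.Completion.continuous_map).comp
        (HeightOneSpectrum.adicCompletion.continuous_toCompletion K v))
  have hcoe : ∀ x : K, adicCompletionMap (K := K) L v w (algebraMap K (v.adicCompletion K) x) =
      algebraMap L (w.adicCompletion L) (algebraMap K L x) := fun x ↦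
    adicCompletionMap_coe (K := K) L v w x
  letI : Algebra (v.adicCompletion K) (w.adicCompletion L) :=
    (adicCompletionMap (K := K) L v w).toAlgebra
  haveI : ContinuousSMul (v.adicCompletion K) (w.adicCompletion L) :=
    ⟨(hcont.comp continuous_fst).mul continuous_snd⟩
  let S : Submodule (v.adicCompletion K) (w.adicCompletion L) :=
    Submodule.span (v.adicCompletion K) {1, algebraMap L (w.adicCompletion L) θ}
  haveI : FiniteDimensional (v.adicCompletion K) S :=
    FiniteDimensional.span_of_finite _ ((Set.finite_singleton _).insert _)
  have hSclosed : IsClosed (S : Set (w.adicCompletion L)) := by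
    open scoped Valued in exact S.closed_of_finiteDimensional
  have h1 : (1 : w.adicCompletion L) ∈ S := Submodule.subset_span (Set.mem_insert _ _)
  have hθS : algebraMap L (w.adicCompletion L) θ ∈ S :=
    Submodule.subset_span (Set.mem_insert_of_mem _ (Set.mem_singleton _))
  have hKS : ∀ a : K, algebraMap L (w.adicCompletion L) (algebraMap K L a) =
      algebraMap K (v.adicCompletion K) a • (1 : w.adicCompletion L) := fun a ↦ by
    rw [Algebra.smul_def, mul_one, RingHom.algebraMap_toAlgebra, hcoe]
  have hLS : Set.range (algebraMap L (w.adicCompletion L)) ⊆ S := by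
    rintro _ ⟨l, rfl⟩
    obtain ⟨a, b, rfl⟩ := hL l
    rw [map_add, map_mul, hKS a, hKS b, smul_mul_assoc, one_mul]
    exact S.add_mem (S.smul_mem _ h1) (S.smul_mem _ hθS)
  have hSuniv : (S : Set (w.adicCompletion L)) = Set.univ := by
    apply Set.eq_univ_of_univ_subset
    rw [← (HeightOneSpectrum.denseRange_algebraMap L w).closure_range]
    exact closure_minimal hLS hSclosed
  have hy : y ∈ S := by
    rw [← SetLike.mem_coe, hSuniv]
    exact Set.mem_univ y
  obtain ⟨a, b, hab⟩ := Submodule.mem_span_pair.mp hy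
  refine ⟨a, b, ?_⟩
  rw [← hab, Algebra.smul_def, Algebra.smul_def, mul_one, RingHom.algebraMap_toAlgebra]

omit [NumberField K] [Algebra K L] in
/-- **Milne I.3.3 at `w ∤ n`: `E(L_w)[n] = 0 ⟹ E(L_w) = n E(L_w)`.** For an elliptic curve `V/L`, a finite
place `w` with `n` a unit of `𝓞_w`: `#E(L_w)/n E(L_w) = #E(L_w)[n] · #(𝓞_w/n 𝓞_w)`
(`card_quotient_range_nsmul_adicCompletion`) `= 1 · 1`. [cite: MilneADT2006, I Lemma 3.3]
[cite: SilvermanAEC2009, Prop. VII.6.3] -/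
theorem forall_exists_zsmul_eq_adicCompletion_of_torsionFree (V : WeierstrassCurve L) [V.IsElliptic]
    (w : HeightOneSpectrum (𝓞 L)) {n : ℕ} (hn : n ≠ 0) (hu : IsUnit ((n : ℕ) : w.adicCompletionIntegers L))
    (htf : ∀ P : (V.baseChange (w.adicCompletion L)).toAffine.Point, (n : ℤ) • P = 0 → P = 0)
    (P : (V.baseChange (w.adicCompletion L)).toAffine.Point) :
    ∃ Q : (V.baseChange (w.adicCompletion L)).toAffine.Point, (n : ℤ) • Q = P := by
  have h := V.card_quotient_range_nsmul_adicCompletion w hn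
  have hker : Nat.card (nsmulAddMonoidHom n : (V.baseChange (w.adicCompletion L)).toAffine.Point →+ _).ker
      = 1 := by
    rw [Nat.card_eq_one_iff_unique]
    refine ⟨⟨fun x y ↦ Subtype.ext ?_⟩, ⟨0⟩⟩
    have hx : (x : (V.baseChange (w.adicCompletion L)).toAffine.Point) = 0 :=
      htf _ (by rw [natCast_zsmul]; exact x.2)
    have hy : (y : (V.baseChange (w.adicCompletion L)).toAffine.Point) = 0 :=
      htf _ (by rw [natCast_zsmul]; exact y.2)
    rw [hx, hy]
  have hq : Nat.card (w.adicCompletionIntegers L ⧸ Ideal.span {(n : w.adicCompletionIntegers L)}) = 1 := by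
    rw [Ideal.span_singleton_eq_top.mpr hu]
    haveI : Subsingleton (w.adicCompletionIntegers L ⧸ (⊤ : Ideal (w.adicCompletionIntegers L))) :=
      Ideal.Quotient.subsingleton_iff.mpr rfl
    exact Nat.card_eq_one_iff_unique.mpr ⟨inferInstance, ⟨0⟩⟩
  rw [hker, hq, mul_one] at h
  have htop : (nsmulAddMonoidHom n : (V.baseChange (w.adicCompletion L)).toAffine.Point →+ _).range = ⊤ :=
    AddSubgroup.index_eq_one.mp h
  obtain ⟨Q, hQ⟩ : P ∈ (nsmulAddMonoidHom n : (V.baseChange (w.adicCompletion L)).toAffine.Point →+ _).range :=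
    htop ▸ AddSubgroup.mem_top P
  exact ⟨Q, by rw [natCast_zsmul]; exact hQ⟩

/-- **The ramified-place input of the exact `2^M`-Selmer descent along `L = K(√c) ⊃ K`.** Let `E = W/K`
be elliptic, `L = K + K θ` with `θ² = c ∈ K^×`, `w ∣ v` finite places with `w ∤ 2`, and suppose
`E(K_v)[2] = 0`. Then, for the `K_v`-algebra `L_w` (map of completions), the subgroup
`E(K̄_v)^{Γ_{L̃_w}}` of `E(K̄_v)` has no `2^M`-torsion and is `2^M`-divisible: it is `j_* E(L_w)` for a
`K_v`-embedding `j : L_w → K̄_v` (§1), `E(L_w)[2^M] = 0` by the index-`2` descent of §2 from `E(K_v)[2] = 0`,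
and `E(L_w) = 2^M E(L_w)` by Milne I.3.3 at `w ∤ 2`. These are literally the hypotheses `htf`, `hdiv` of
`mem_localRestrictionKer_adicCompletion_of_fixedPoints_divisible`. [cite: SilvermanAEC2009, VIII.§1 and Prop. VII.6.3]
[cite: MilneADT2006, I Lemma 3.3] [cite: DokchitserDokchitserAnnals2010, Lemma 4.14 (proof)] -/
theorem fixedPoints_twoPow_torsionFree_and_divisible_adicCompletion [W.IsElliptic] {θ : L} {c : K}
    (hc : c ≠ 0) (hθ : θ ^ 2 = algebraMap K L c)
    (hL : ∀ x : L, ∃ a b : K, x = algebraMap K L a + algebraMap K L b * θ)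
    {v : HeightOneSpectrum (𝓞 K)} (w : HeightOneSpectrum (𝓞 L)) [w.asIdeal.LiesOver v.asIdeal]
    (h2w : ((2 : ℕ) : 𝓞 L) ∉ w.asIdeal)
    (htors : ∀ P : (W.baseChange (v.adicCompletion K)).toAffine.Point, (2 : ℤ) • P = 0 → P = 0)
    (M : ℕ) :
    letI : Algebra (v.adicCompletion K) (w.adicCompletion L) :=
      (adicCompletionMap (K := K) L v w).toAlgebra
    (∀ a : localPoints W (v.adicCompletion K),
      (∀ g ∈ finGalSubgroup (E := v.adicCompletion K) (w.adicCompletion L), g • a = a) →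
        ((2 : ℤ) ^ M) • a = 0 → a = 0) ∧
    (∀ a : localPoints W (v.adicCompletion K),
      (∀ g ∈ finGalSubgroup (E := v.adicCompletion K) (w.adicCompletion L), g • a = a) →
        ∃ b : localPoints W (v.adicCompletion K),
          (∀ g ∈ finGalSubgroup (E := v.adicCompletion K) (w.adicCompletion L), g • b = b) ∧
            ((2 : ℤ) ^ M) • b = a) := by
  letI : Algebra (v.adicCompletion K) (w.adicCompletion L) :=
    (adicCompletionMap (K := K) L v w).toAlgebra
  haveI : IsScalarTower K (v.adicCompletion K) (w.adicCompletion L) :=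
    IsScalarTower.of_algebraMap_eq fun x ↦ (adicCompletionMap_coe (K := K) L v w x).symm
  haveI : FiniteDimensional (v.adicCompletion K) (w.adicCompletion L) :=
    (finrank_adicCompletion_le_of_liesOver L v w).1
  haveI : CharZero (v.adicCompletion K) :=
    charZero_of_injective_algebraMap (algebraMap K (v.adicCompletion K)).injective
  haveI : Algebra.IsAlgebraic (v.adicCompletion K) (w.adicCompletion L) :=
    Algebra.IsAlgebraic.of_finite _ _
  let j : w.adicCompletion L →ₐ[v.adicCompletion K] AlgebraicClosure (v.adicCompletion K) :=
    IsAlgClosed.lift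
  -- `L_w = K_v + K_v θ`, `θ² = c`
  have hE' : ∀ y : w.adicCompletion L, ∃ a b : v.adicCompletion K,
      y = algebraMap (v.adicCompletion K) (w.adicCompletion L) a +
        algebraMap (v.adicCompletion K) (w.adicCompletion L) b * algebraMap L (w.adicCompletion L) θ :=
    exists_eq_add_mul_adicCompletion' L hL v w
  have hθ' : (algebraMap L (w.adicCompletion L) θ) ^ 2 =
      algebraMap (v.adicCompletion K) (w.adicCompletion L) (algebraMap K (v.adicCompletion K) c) := by
    rw [← map_pow, hθ, RingHom.algebraMap_toAlgebra]
    exact (adicCompletionMap_coe (K := K) L v w c).symm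
  have hc' : algebraMap K (v.adicCompletion K) c ≠ 0 :=
    (map_ne_zero_iff _ (algebraMap K (v.adicCompletion K)).injective).mpr hc
  -- `E(L_w)` has no `2^M`-torsion (index-`2` descent from `E(K_v)[2] = 0`) …
  have htfE' : ∀ P : (W.baseChange (w.adicCompletion L)).toAffine.Point, ((2 : ℤ) ^ M) • P = 0 → P = 0 :=
    forall_point_eq_zero_of_two_pow_smul_eq_zero W j hc' hθ' hE' htors M
  -- … hence is `2^M`-divisible (Milne I.3.3 at `w ∤ 2`, on `(W_L)_{L_w} = W_{L_w}`)
  haveI : (W.baseChange L).IsElliptic := by rw [baseChange]; infer_instance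
  have h2M : ((2 ^ M : ℕ) : ℤ) = (2 : ℤ) ^ M := by push_cast; rfl
  have hu : IsUnit (((2 ^ M : ℕ) : ℕ) : w.adicCompletionIntegers L) := by
    have h := IsDedekindDomain.HeightOneSpectrum.isUnit_algebraMap_adicCompletionIntegers L w h2w
    rw [map_natCast] at h
    rw [Nat.cast_pow]
    exact h.pow M
  have hdivE' : ∀ P : (W.baseChange (w.adicCompletion L)).toAffine.Point,
      ∃ Q : (W.baseChange (w.adicCompletion L)).toAffine.Point, ((2 : ℤ) ^ M) • Q = P := by
    intro P
    let e := pointsCongr W L (w.adicCompletion L)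
    have htf'' : ∀ P' : ((W.baseChange L).baseChange (w.adicCompletion L)).toAffine.Point,
        ((2 ^ M : ℕ) : ℤ) • P' = 0 → P' = 0 := by
      intro P' hP'
      apply e.symm.injective
      rw [map_zero]
      apply htfE'
      rw [← h2M, ← map_zsmul, hP', map_zero]
    obtain ⟨Q', hQ'⟩ := forall_exists_zsmul_eq_adicCompletion_of_torsionFree L (W.baseChange L) w
      (pow_ne_zero M two_ne_zero) hu htf'' (e P)
    refine ⟨e.symm Q', ?_⟩
    rw [← h2M, ← map_zsmul, hQ', e.symm_apply_apply]
  exact ⟨fun a ha hMa ↦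
      eq_zero_of_forall_finGalSubgroup_smul_eq_of_two_pow_smul_eq_zero W j hc' hθ' hE' htors M ha hMa,
    fun a ha ↦ exists_fixed_smul_eq_of_forall_finGalSubgroup_smul_eq W j hθ' hE' hdivE' ha⟩

end NumberField

end Literature.NumberTheory.EllipticCurves

end
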